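import Literature.AlgebraicGeometry.Resolution.RegularLocusPerfectField
import Literature.AlgebraicGeometry.Resolution.NormalSurfaceSingularLocus
import Literature.AlgebraicGeometry.Resolution.NormalCurvesOverPerfectFields
import Mathlib.RingTheory.Smooth.Pi
import Mathlib.RingTheory.Ideal.Height
import HarnessLib

/-!
# Normal one-dimensional algebras of finite type over a perfect field are smooth — the non-integral case
# ([GortzWedhorn2020] Prop. 6.42 / Thm. 6.28; [Matsumura1987] Thm. 11.2; [StacksProject 00TV, 030C])

Topic `Literature/AlgebraicGeometry/Resolution`; namespace `Literature.AlgebraicGeometry.Resolution.NormalCurve`.  PROOF FILE (theorems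
only; no definition, no named fact, no instance, no `sorry`).  Cell `hodgecm-mathlib` (D-0151), FLOOR 0, programme F0P5a (D9op road 2′, crux
item stmt-HodgeConjecture-24832), MOD-PLAN L6.6 FILE 2 (`RelativeSpec/GeometricQuotientTameSmoothCurve`) sub-piece **(N1)** (F0P5a-plan (g2)
02:03:36Z «normal 1-dim of finite type over a perfect field, possibly NON-integral ⇒ smooth»): the special ∕ generic fibre `X_y ∕ G` of a tame
finite-group quotient of a smooth relative curve is a NORMAL one-dimensional scheme of finite type over the perfect field `κ(y)`, in general
NOT integral (the curve need not be geometrically connected); this file removes the integrality hypothesis of ★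
`NormalCurve.smooth_of_perfectField_of_isIntegrallyClosed` (`NormalCurvesOverPerfectFields.lean`, the DOMAIN case).

«Normal» for a ring that need not be a domain = every localisation at a prime is an integrally closed DOMAIN ([StacksProject 00GV, 030C]:
a Noetherian normal ring is a finite product of integrally closed domains).  Over a PERFECT field, smooth at a prime ⇔ the local ring is
regular (★ `isSmoothAt_iff_isRegularLocalRing_of_perfectField`, [GortzWedhorn2020] Thm. 6.28 / [StacksProject 00TV]), and a normal
Noetherian local domain of dimension `≤ 1` is regular — a field or a discrete valuation ring ([Matsumura1987] Thm. 11.2, ★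
`isRegularLocalRing_of_isIntegrallyClosed_of_ringKrullDim_le_one`).

* §1 **`smooth_of_perfectField_of_isIntegrallyClosed_localization`** — `B` of finite type over a perfect field `l`, `dim B ≤ 1`, every
  `B_𝔭` an integrally closed domain ⇒ `Algebra.Smooth l B`; `isSmoothAt_of_isIntegrallyClosed_localization` the pointwise form (only the
  local ring at the given prime is assumed normal of dimension `≤ 1`).
* §2 **`smooth_pi_of_perfectField_of_isIntegrallyClosed`** — the PRODUCT form: a finite product of integrally closed domains of dimension `≤ 1`
  and finite type over a perfect field is smooth (★ domain case + Mathlib `Algebra.FormallySmooth`∕`FinitePresentation` of finite products);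
  `smooth_of_algEquiv_pi` the same transported along an `l`-algebra isomorphism `B ≃ₐ[l] Π i, B i` (the shape in which a complete orthogonal
  family of idempotents with normal corners presents `B`).

HC_CM is proved only modulo the 7 printed citations until rung 0 closes; this file is generic commutative algebra and changes no count.

## References
* [GortzWedhorn2020] U. Görtz, T. Wedhorn, *Algebraic Geometry I* (2nd ed. 2020): Thm. 6.28 (smooth ⇔ geometrically regular), Prop. 6.42
  / Prop. 6.40 (normal curves over perfect fields are smooth).
* [Matsumura1987] H. Matsumura, *Commutative Ring Theory*, Thm. 11.2 (normal Noetherian local domain of dimension one = DVR = regular).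
* [StacksProject] The Stacks Project: Tag 00TV (smooth over a field at a point ⇔ regular, perfect case), Tag 00GV / 030C (normal rings).
-/

set_option autoImplicit false

namespace Literature.AlgebraicGeometry.Resolution.NormalCurve

universe u v w

open IsLocalRing

/-! ### §1 The intrinsic form: locally an integrally closed domain of dimension `≤ 1` -/

section Intrinsic

variable (l B : Type u) [Field l] [PerfectField l] [CommRing B] [Algebra l B] [Algebra.FiniteType l B]

/-- **Smooth at a normal point of dimension `≤ 1`** (perfect ground field): if the local ring `B_𝔮` of the finite-type `l`-algebra `B` at the
prime `𝔮` is an integrally closed DOMAIN of Krull dimension `≤ 1`, then `B` is smooth over `l` at `𝔮` (`B_𝔮` is a field or a DVR, hence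
regular, [Matsumura1987] Thm. 11.2; regular ⇒ smooth over a perfect field, [StacksProject 00TV]).
[cite: GortzWedhorn2020, Thm. 6.28] [cite: Matsumura1987, Thm. 11.2] [cite: StacksProject, Tag 00TV] -/
theorem isSmoothAt_of_isIntegrallyClosed_localization (q : Ideal B) [q.IsPrime]
    [IsDomain (Localization.AtPrime q)] [IsIntegrallyClosed (Localization.AtPrime q)]
    (hdim : ringKrullDim (Localization.AtPrime q) ≤ 1) : Algebra.IsSmoothAt l q := by
  haveI : IsNoetherianRing B := Algebra.FiniteType.isNoetherianRing l B
  haveI : IsNoetherianRing (Localization.AtPrime q) := IsLocalization.isNoetherianRing q.primeCompl _ inferInstance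
  rw [isSmoothAt_iff_isRegularLocalRing_of_perfectField l B q]
  exact isRegularLocalRing_of_isIntegrallyClosed_of_ringKrullDim_le_one (Localization.AtPrime q) hdim

/-- **Normal one-dimensional algebras of finite type over a perfect field are smooth — non-integral case.**  Let `l` be a perfect field and
`B` an `l`-algebra of finite type with `dim B ≤ 1` whose localisations at all primes are integrally closed DOMAINS («`B` normal»,
[StacksProject 00GV]; e.g. a finite product of Dedekind domains, or the ring of a `G`-stable affine chart of the quotient of a smooth,
possibly disconnected, curve by a finite group).  Then `B` is smooth over `l`.  Smoothness is checked at every prime `𝔮` (Mathlib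
`Algebra.smoothLocus_eq_univ_iff`), where `dim B_𝔮 = ht 𝔮 ≤ dim B ≤ 1` and `isSmoothAt_of_isIntegrallyClosed_localization` applies.
[cite: GortzWedhorn2020, Prop. 6.42] [cite: Matsumura1987, Thm. 11.2] [cite: StacksProject, Tag 00TV] -/
theorem smooth_of_perfectField_of_isIntegrallyClosed_localization
    (hdom : ∀ (q : Ideal B) [q.IsPrime], IsDomain (Localization.AtPrime q))
    (hint : ∀ (q : Ideal B) [q.IsPrime], IsIntegrallyClosed (Localization.AtPrime q))
    (hdim : ringKrullDim B ≤ 1) : Algebra.Smooth l B := by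
  haveI : IsNoetherianRing B := Algebra.FiniteType.isNoetherianRing l B
  haveI : Algebra.FinitePresentation l B := (Algebra.FinitePresentation.of_finiteType).mp ‹_›
  refine ⟨Algebra.smoothLocus_eq_univ_iff.mp (Set.eq_univ_iff_forall.mpr fun P => ?_), ‹_›⟩
  show Algebra.IsSmoothAt l P.asIdeal
  haveI := hdom P.asIdeal
  haveI := hint P.asIdeal
  refine isSmoothAt_of_isIntegrallyClosed_localization l B P.asIdeal ?_
  rw [IsLocalization.AtPrime.ringKrullDim_eq_height P.asIdeal (Localization.AtPrime P.asIdeal)]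
  exact (Ideal.height_le_ringKrullDim_of_isPrime (I := P.asIdeal)).trans hdim

/-- The same with the dimension hypothesis as the class `Ring.KrullDimLE 1 B` (the binder of ★ `smooth_of_perfectField_of_isIntegrallyClosed`).
[cite: GortzWedhorn2020, Prop. 6.42] [cite: Matsumura1987, Thm. 11.2] -/
theorem smooth_of_perfectField_of_isIntegrallyClosed_localization' [Ring.KrullDimLE 1 B]
    (hdom : ∀ (q : Ideal B) [q.IsPrime], IsDomain (Localization.AtPrime q))
    (hint : ∀ (q : Ideal B) [q.IsPrime], IsIntegrallyClosed (Localization.AtPrime q)) : Algebra.Smooth l B :=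
  smooth_of_perfectField_of_isIntegrallyClosed_localization l B hdom hint (Ring.krullDimLE_iff.mp ‹_›)

end Intrinsic

/-! ### §2 The product form -/

section Product

variable (l : Type u) [Field l] [PerfectField l]

/-- **A finite product of normal one-dimensional domains of finite type over a perfect field is smooth**: for `Bᵢ` (finitely many)
integrally closed domains of Krull dimension `≤ 1` and finite type over the perfect field `l`, `Π i, Bᵢ` is smooth over `l` (each factor is
smooth by the integral case ★ `smooth_of_perfectField_of_isIntegrallyClosed`; finite products of smooth algebras are smooth, Mathlib
`Algebra.FormallySmooth`∕`Algebra.FinitePresentation` instances for `Π`).  This is the coordinate ring of a disjoint union of smooth affine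
curves. [cite: GortzWedhorn2020, Prop. 6.42] [cite: StacksProject, Tag 030C] -/
theorem smooth_pi_of_perfectField_of_isIntegrallyClosed {ι : Type u} [Finite ι] (B : ι → Type u) [∀ i, CommRing (B i)]
    [∀ i, IsDomain (B i)] [∀ i, Algebra l (B i)] [∀ i, Algebra.FiniteType l (B i)] [∀ i, IsIntegrallyClosed (B i)]
    [∀ i, Ring.KrullDimLE 1 (B i)] : Algebra.Smooth l (Π i, B i) := by
  haveI : ∀ i, Algebra.Smooth l (B i) := fun i => smooth_of_perfectField_of_isIntegrallyClosed l (B i)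
  haveI : ∀ i, Algebra.FormallySmooth l (B i) := fun i => Algebra.Smooth.formallySmooth
  haveI : ∀ i, Algebra.FinitePresentation l (B i) := fun i => Algebra.Smooth.finitePresentation
  exact ⟨inferInstance, inferInstance⟩

/-- **Transport along a product decomposition**: if `B ≃ₐ[l] Π i, Bᵢ` with `Bᵢ` as in `smooth_pi_of_perfectField_of_isIntegrallyClosed`,
then `B` is smooth over `l` (the presentation of a reduced normal ring of finite type by its primitive idempotents ∕ irreducible
components, [StacksProject 030C]). [cite: GortzWedhorn2020, Prop. 6.42] [cite: StacksProject, Tag 030C] -/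
theorem smooth_of_algEquiv_pi {ι : Type u} [Finite ι] (B : ι → Type u) [∀ i, CommRing (B i)]
    [∀ i, IsDomain (B i)] [∀ i, Algebra l (B i)] [∀ i, Algebra.FiniteType l (B i)] [∀ i, IsIntegrallyClosed (B i)]
    [∀ i, Ring.KrullDimLE 1 (B i)] {A : Type u} [CommRing A] [Algebra l A] (e : A ≃ₐ[l] Π i, B i) : Algebra.Smooth l A := by
  haveI := smooth_pi_of_perfectField_of_isIntegrallyClosed l B
  haveI : Algebra.FormallySmooth l (Π i, B i) := Algebra.Smooth.formallySmooth
  haveI : Algebra.FinitePresentation l (Π i, B i) := Algebra.Smooth.finitePresentation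
  exact ⟨Algebra.FormallySmooth.of_equiv e.symm, Algebra.FinitePresentation.equiv e.symm⟩

end Product

end Literature.AlgebraicGeometry.Resolution.NormalCurve
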